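import Literature.NumberTheory.LFunctions.IwaniecSarnakFamilyWeightTwoPrimeEdge
import Literature.NumberTheory.LFunctions.KowalskiMichelPeterssonFormula
import HarnessLib

/-!
# Weight-2 prime-level masses, even share and the decision theorems RE-THREADED to the Petersson bound
# in its printed range (`kowalskiMichel2000_peterssonBound`, Kowalski–Michel 2000 p. 310 / (23))

Topic `Literature/NumberTheory/LFunctions` (namespace `Literature.NumberTheory.LFunctions.CentralValueFamilyHalfEdge`,
as the originals). PROOFS only — no definition, no named fact (D-0026). Cell landau-siegel, D-0124 rescue W1 event
R2-G44 (director rulings 2026-08-27 11:41:46Z / 11:46:35Z), typer seat ls-rescue-typ-1.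

WHY. The named fact `KowalskiMichel2000.kowalskiMichel2000_petersson` (the p. 310 display typed for ALL `m, n ≥ 1`)
is FALSE AS TYPED — `KowalskiMichel2000.not_kowalskiMichel2000_petersson` (Atkin–Lehner at `(m,n) = (q,q)`;
`KowalskiMichelPeterssonFormula.lean`) — while the print is fine: the corrected fact of record is
`KowalskiMichel2000.kowalskiMichel2000_peterssonBound` (same display, extra binder `¬ (q ∣ m ∧ q ∣ n)`, i.e.
`((m,n),q) = 1` for prime `q`, `gcd_coprime_iff_not_dvd` — the range where (23) follows from Weil's bound;
rev 3 of that file). Every theorem of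
`IwaniecSarnakFamilyWeightTwo` / `IwaniecSarnakFamilyWeightTwoPrimeEdge` carrying the binder
`(hP : kowalskiMichel2000_petersson)` is therefore an implication from a false premise. This file lands their
ADDITIVE twins (`…_pb`) from the corrected fact; the originals are left untouched (append discipline), and nothing
here uses `¬ kowalskiMichel2000_petersson` (no ex falso — smuggling rule). The only instantiation point in this
layer is `(m, n) = (1, 1)` (`masses_prime_weightTwo`), where the side condition reads `¬ (q ∣ 1 ∧ q ∣ 1)`
(`KowalskiMichel2000.not_dvd_and_dvd_one`); everything else passes the hypothesis through verbatim.

* `masses_prime_weightTwo_pb`, `evenShare_primeLevelFamilyTwo_pb`,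
  `lOne_lowerBound_of_untwistedProportion_weightTwo_withLemma1_pb` (twin of the FIVE-fact
  `lOne_lowerBound_of_untwistedProportion_weightTwo`), `lOne_lowerBound_of_EStarFam_prime_weightTwo_withLemma1_pb` (twin of
  the FIVE-fact `lOne_lowerBound_of_EStarFam_prime_weightTwo` of `…PrimeEdge`) — statements IDENTICAL to the originals
  except for the binder `(hP : KowalskiMichel2000.kowalskiMichel2000_peterssonBound)` (suffix `_pb` = «Petersson bound in
  range», the re-thread suffix of record, director-frontier 2026-08-27 11:56:05Z). NAMING NOTE: the plain names
  `lOne_lowerBound_of_untwistedProportion_weightTwo_pb` / `lOne_lowerBound_of_EStarFam_prime_weightTwo_pb` are taken by the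
  twins of the FOUR-fact (Petersson-alone, primed) versions in `IwaniecSarnakFamilyWeightTwoPeterssonPB` (p530888); the
  five-fact twins here, which additionally carry `kowalskiMichel2000_lemma1`, are suffixed `_withLemma1_pb`.

«refuted-as-typed ≠ refuted-in-print» · «The programme SEARCHES and TYPES; no claim about Landau–Siegel zeros,
Theorems 1–2 of arXiv:2211.02515 or a repaired Margin232 until a kernel theorem says so.»

## References

* [KowalskiMichel2000] E. Kowalski, P. Michel, Acta Arith. 94 (2000), §2.3 p. 310 (display after (16)), §2.4.2 (23),
  Lemma 1.
* [IwaniecConversations2006] H. Iwaniec, LNM 1891 (2006), §7 (7.3)–(7.7), p. 97.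
* Tree: `IwaniecSarnakFamilyWeightTwo` (p467198), `IwaniecSarnakFamilyWeightTwoPrimeEdge`,
  `KowalskiMichelPeterssonFormula` (p528813 and its revs).
-/

noncomputable section

namespace Literature.NumberTheory.LFunctions.CentralValueFamilyHalfEdge

open scoped MatrixGroups
open Finset Real CongruenceSubgroup Complex
open Literature.NumberTheory.EllipticCurves.ModularForms
open Literature.NumberTheory.LFunctions.IwaniecSarnak

/-! ### The twins (binder `kowalskiMichel2000_peterssonBound`) -/

/-- **Total and odd harmonic masses at prime level, weight `2`** — twin of `masses_prime_weightTwo` from the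
Petersson bound IN ITS RANGE (instantiated at `(m,n) = (1,1)`, side condition `¬ (q ∣ 1 ∧ q ∣ 1)`) and Lemma 1 at
`(l,m) = (1,1)`: `|Σ^h 1 − 1| ≤ C₁ q^{−3/2}` and `|2·Σ^h_{odd} 1 − 1| ≤ C₂ q^{−1}` for every prime `q`.
[cite: KowalskiMichel2000, §2.3 (display after (16)) and Lemma 1] -/
theorem masses_prime_weightTwo_pb (hP : KowalskiMichel2000.kowalskiMichel2000_peterssonBound)
    (hL : KowalskiMichel2000.kowalskiMichel2000_lemma1) :
    ∃ C₁ C₂ : ℝ, ∀ (q : ℕ) [NeZero q], q.Prime →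
      |harmonicSum q 2 (fun _ => (1 : ℝ)) - 1| ≤ C₁ * (q : ℝ) ^ (-(3 / 2 : ℝ)) ∧
      |2 * harmonicSum q 2 (fun f => if rootNumber f = 1 then (0 : ℝ) else 1) - 1| ≤ C₂ / q := by
  obtain ⟨C₁, h₁⟩ := hP 1 one_pos
  obtain ⟨C₂, h₂⟩ := hL 1 one_pos
  refine ⟨C₁, C₂, fun q _ hq => ⟨?_, ?_⟩⟩
  · have h := h₁ q hq 1 1 le_rfl le_rfl (KowalskiMichel2000.not_dvd_and_dvd_one hq 1)
    rw [pet_one_one, if_pos rfl] at h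
    have e : (((harmonicSum q 2 (fun _ => (1 : ℝ)) : ℝ) : ℂ) - 1) =
        (((harmonicSum q 2 (fun _ => (1 : ℝ)) - 1 : ℝ)) : ℂ) := by push_cast; ring
    rw [e, Complex.norm_real, Real.norm_eq_abs] at h
    simpa using h
  · have h := h₂ q hq 1 1 le_rfl le_rfl hq.one_lt.le
    rw [deltaMinus_one_one, if_pos rfl] at h
    have e : (2 * (((harmonicSum q 2 (fun f => if rootNumber f = 1 then (0 : ℝ) else 1)) : ℝ) : ℂ)
        - 1) = (((2 * harmonicSum q 2 (fun f => if rootNumber f = 1 then (0 : ℝ) else 1) - 1 : ℝ))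
          : ℂ) := by push_cast; ring
    rw [e, Complex.norm_real, Real.norm_eq_abs] at h
    simpa using h

/-- **Even share at prime level, weight `2`** — twin of `evenShare_primeLevelFamilyTwo` from the Petersson bound in
its range: for all large primes `q`, `Σ^h_{w_f = 1} ω_f ≥ (1/5)·Σ^h ω_f` and `Σ^h ω_f > 0` over `H_2(q)`.
[cite: KowalskiMichel2000, §2.3 (display after (16)) and Lemma 1] -/
theorem evenShare_primeLevelFamilyTwo_pb (hP : KowalskiMichel2000.kowalskiMichel2000_peterssonBound)
    (hL : KowalskiMichel2000.kowalskiMichel2000_lemma1) : primeLevelFamilyTwo.EvenShare := by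
  obtain ⟨C₁, C₂, hC⟩ := masses_prime_weightTwo_pb hP hL
  refine ⟨1 / 5, by norm_num, max (max (8 * C₁) (4 * C₂)) 1,
    fun (N : ℕ+) (hadm : Squarefree (N : ℕ) ∧ (N : ℕ).Prime)
      (hsz : max (max (8 * C₁) (4 * C₂)) 1 ≤ ((N : ℕ) : ℝ)) => ?_⟩
  obtain ⟨_, hprime⟩ := hadm
  show 1 / 5 * (iwaniecSarnakFamily 2).totalMass N ≤ (iwaniecSarnakFamily 2).evenMass N ∧
    0 < (iwaniecSarnakFamily 2).totalMass N
  rw [totalMass_iwaniecSarnakFamily, evenMass_iwaniecSarnakFamily]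
  set q : ℕ := (N : ℕ) with hqdef
  have hq1 : (1 : ℝ) ≤ q := le_trans (le_max_right _ _) hsz
  have hqpos : (0 : ℝ) < q := lt_of_lt_of_le one_pos hq1
  have h8 : 8 * C₁ ≤ q := le_trans (le_trans (le_max_left _ _) (le_max_left _ _)) hsz
  have h4 : 4 * C₂ ≤ q := le_trans (le_trans (le_max_right _ _) (le_max_left _ _)) hsz
  obtain ⟨hT, hO⟩ := hC q hprime
  -- the two error terms are ≤ 1/8 and ≤ 1/4
  have ha : C₁ * (q : ℝ) ^ (-(3 / 2 : ℝ)) ≤ 1 / 8 := by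
    have hrpow : (q : ℝ) ^ (-(3 / 2 : ℝ)) ≤ (q : ℝ)⁻¹ := by
      rw [← Real.rpow_neg_one]
      exact Real.rpow_le_rpow_of_exponent_le hq1 (by norm_num)
    have hrpos : 0 ≤ (q : ℝ) ^ (-(3 / 2 : ℝ)) := Real.rpow_nonneg hqpos.le _
    rcases le_or_gt 0 C₁ with hc | hc
    · calc C₁ * (q : ℝ) ^ (-(3 / 2 : ℝ)) ≤ C₁ * (q : ℝ)⁻¹ := mul_le_mul_of_nonneg_left hrpow hc
        _ ≤ 1 / 8 := by rw [← div_eq_mul_inv, div_le_iff₀ hqpos]; linarith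
    · linarith [mul_nonpos_of_nonpos_of_nonneg hc.le hrpos,
        show C₁ * (q : ℝ) ^ (-(3 / 2 : ℝ)) ≤ 0 from mul_nonpos_of_nonpos_of_nonneg hc.le hrpos]
  have hb : C₂ / q ≤ 1 / 4 := by
    rw [div_le_iff₀ hqpos]; linarith
  have hT' := abs_le.mp (le_trans hT ha)
  have hO' := abs_le.mp (le_trans hO hb)
  -- even = total − odd
  have hsplit := harmonicSum_one_eq_even_add_odd q
  constructor
  · linarith [hT'.1, hT'.2, hO'.1, hO'.2]
  · linarith [hT'.1]

/-- **The weight-2 decision theorem (printed facts + the record-form edge ⇒ no tiny `L(1,χ_D)`)** — twin of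
`lOne_lowerBound_of_untwistedProportion_weightTwo` with the Petersson input in its printed range. Assume
`lapidRallis2003_theorem1_gl2Twist`, `iwaniec2006_twistedHalf`, `iwaniec2006_mixedMomentOverMass`,
`kowalskiMichel2000_peterssonBound`, `kowalskiMichel2000_lemma1`; then the EDGE `UntwistedProportion 2 (½ + η)`
(`η > 0`) implies `∃ c > 0, ∃ D₀, ∀ D ≥ D₀, ∀ real primitive χ mod D: c·(log D)⁻⁴ ≤ L(1,χ)`.
[cite: IwaniecConversations2006, §7 (7.7) and p. 97] -/
theorem lOne_lowerBound_of_untwistedProportion_weightTwo_withLemma1_pb {η : ℝ} (hη : 0 < η)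
    (hLR : lapidRallis2003_theorem1_gl2Twist) (hTw : iwaniec2006_twistedHalf)
    (hMix : iwaniec2006_mixedMomentOverMass)
    (hP : KowalskiMichel2000.kowalskiMichel2000_peterssonBound)
    (hL : KowalskiMichel2000.kowalskiMichel2000_lemma1)
    (hUn : UntwistedProportion 2 (1 / 2 + η)) :
    ∃ c : ℝ, 0 < c ∧ ∃ D₀ : ℕ, ∀ (D : ℕ) [NeZero D] (χ : DirichletCharacter ℂ D), D₀ ≤ D →
      χ.IsPrimitive → MulChar.IsQuadratic χ →
        c * ((Real.log D) ^ 4)⁻¹ ≤ (χ.LFunction 1).re := by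
  have hk : (2 : ℤ) ≤ 2 := le_rfl
  have hkev : Even (2 : ℤ) := ⟨1, rfl⟩
  obtain ⟨δ₁, hδ₁, htot⟩ := mixedOverTotalMass_iwaniecSarnakFamily hk hkev hMix
  have hε : 0 < η / 4 := by positivity
  obtain ⟨δ₂, hδ₂, htw⟩ := TwistedHalf_of_twistedProportion hε (hTw 2 hk hkev)
  have hE := EStarFam_of_untwistedProportion hε hUn
  have hδ : 0 < min δ₁ δ₂ := lt_min hδ₁ hδ₂
  obtain ⟨K, hK, hsup⟩ := primeLevelFamilyTwo_compatibleSupply hδ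
  have h := primeLevelFamilyTwo.lOne_lowerBound_of_EStarFam_total' hK
    (primeLevelFamilyTwo_nonnegOn hLR) (fun _ _ _ _ hcomp => CentralValueFamily.refine_compatible_B hcomp)
    (evenShare_primeLevelFamilyTwo_pb hP hL)
    (CentralValueFamily.refine_mixedOverTotalMass (htot.anti (min_le_left _ _)))
    (CentralValueFamily.refine_twistedHalf (htw.anti (min_le_right _ _)))
    (CentralValueFamily.refine_EStarFam hE) (by linarith) hsup
  simpa only [show (2 * 2 : ℕ) = 4 from rfl] using h

/-- **The weight-2 decision theorem with the edge at PRIME levels only** — twin of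
`lOne_lowerBound_of_EStarFam_prime_weightTwo` with the Petersson input in its printed range: printed hypotheses
`lapidRallis2003_theorem1_gl2Twist`, `iwaniec2006_twistedHalf`, `iwaniec2006_mixedMomentOverMass`,
`kowalskiMichel2000_peterssonBound`, `kowalskiMichel2000_lemma1`; EDGE `primeLevelFamilyTwo.EStarFam p₁ 2`, `p₁ > ½`;
conclusion `∃ c > 0, L(1,χ_D) ≥ c·(log D)⁻⁴` for all large `D`. [cite: IwaniecConversations2006, §7 (7.7) and p. 97] -/
theorem lOne_lowerBound_of_EStarFam_prime_weightTwo_withLemma1_pb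
    (hLR : lapidRallis2003_theorem1_gl2Twist) (hTw : iwaniec2006_twistedHalf)
    (hMix : iwaniec2006_mixedMomentOverMass)
    (hP : KowalskiMichel2000.kowalskiMichel2000_peterssonBound)
    (hL : KowalskiMichel2000.kowalskiMichel2000_lemma1)
    {p₁ : ℝ} (hp : 1 / 2 < p₁) (hE : primeLevelFamilyTwo.EStarFam p₁ 2) :
    ∃ c : ℝ, 0 < c ∧ ∃ D₀ : ℕ, ∀ (D : ℕ) [NeZero D] (χ : DirichletCharacter ℂ D), D₀ ≤ D →
      χ.IsPrimitive → MulChar.IsQuadratic χ →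
        c * ((Real.log D) ^ 4)⁻¹ ≤ (χ.LFunction 1).re := by
  have hk : (2 : ℤ) ≤ 2 := le_rfl
  have hkev : Even (2 : ℤ) := ⟨1, rfl⟩
  obtain ⟨δ₁, hδ₁, htot⟩ := mixedOverTotalMass_iwaniecSarnakFamily hk hkev hMix
  have hε : 0 < (p₁ - 1 / 2) / 2 := by linarith
  obtain ⟨δ₂, hδ₂, htw⟩ := TwistedHalf_of_twistedProportion hε (hTw 2 hk hkev)
  have hδ : 0 < min δ₁ δ₂ := lt_min hδ₁ hδ₂
  obtain ⟨K, hK, hsup⟩ := primeLevelFamilyTwo_compatibleSupply hδ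
  have h := primeLevelFamilyTwo.lOne_lowerBound_of_EStarFam_total' hK
    (primeLevelFamilyTwo_nonnegOn hLR) (fun _ _ _ _ hcomp => CentralValueFamily.refine_compatible_B hcomp)
    (evenShare_primeLevelFamilyTwo_pb hP hL)
    (CentralValueFamily.refine_mixedOverTotalMass (htot.anti (min_le_left _ _)))
    (CentralValueFamily.refine_twistedHalf (htw.anti (min_le_right _ _)))
    hE (by linarith) hsup
  simpa only [show (2 * 2 : ℕ) = 4 from rfl] using h

end Literature.NumberTheory.LFunctions.CentralValueFamilyHalfEdge

end
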